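import Mathlib.RingTheory.PowerSeries.Trunc
import Mathlib.RingTheory.PowerSeries.Order
import Mathlib.RingTheory.PowerSeries.Inverse
import Mathlib.Algebra.Polynomial.Taylor
import Mathlib.Algebra.Polynomial.Inductions
import Mathlib.Algebra.Polynomial.Div
import HarnessLib

/-!
# The étale Taylor shift of a simple formal root (Puiseux theory, formal half)

Topic `Literature/FieldTheory/AlgClosed` (joins the story of `NewtonPuiseux.lean`:
the substitution `x = sⁿ` produces formal roots `w(s) ∈ K⟦s⟧` of a polynomial
`F(s, Y) ∈ K[s][Y]`; this file turns a SIMPLE formal root into an ÉTALE point).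

Let `K` be a field, `F ∈ K[s][Y]` and `w ∈ K⟦s⟧` a simple root of `F` over `K⟦s⟧`
(`F(s, w) = 0`, `∂_Y F(s, w) ≠ 0`, the latter of `s`-order `m`). For every `N > m` write
`w = T + sᴺ·u` with `T = ` the truncation of `w` below degree `N` (a POLYNOMIAL) and
`u ∈ K⟦s⟧`, `u(0) = w_N`. Then the shifted polynomial `F(s, T(s) + sᴺ·Y) ∈ K[s][Y]` is
divisible by `s^{N+m}` and the quotient `G` satisfies `G(0, u(0)) = 0`, `∂_Y G(0, u(0)) ≠ 0`:
after the shift the branch passes through an ÉTALE point of the curve `G = 0` over `s = 0`.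
(Taylor expansion of `F` at `w`: the `Y¹`-coefficient `sᴺ ∂_Y F(s,w)` has order exactly `N + m`,
the `Y⁰`-coefficient vanishes, the `Yʲ`, `j ≥ 2`, coefficients are divisible by `s^{2N}`,
`2N > N + m`.) This is the formal content of the classical remark that a Puiseux branch, once
enough of its jet is subtracted and divided out, is given by the implicit function theorem
(e.g. Bochnak–Coste–Roy, *Real Algebraic Geometry*, §8.1, proof of Prop. 8.1.8 via the
Artin–Mazur description; Kollár, *Lectures on Resolution of Singularities*, 1.94–1.95). It is
the device by which CONVERGENCE of formal Puiseux roots is obtained from the holomorphic implicit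
function theorem, without majorant series.

## Main statements

* `Literature.FieldTheory.AlgClosed.exists_etaleShift`: the statement above, for every `N₀` some
  `N ≥ N₀` (so that finitely many roots can be shifted with a common, arbitrarily large `N`).
* `Literature.FieldTheory.AlgClosed.trunc_ne_trunc_of_ne`: distinct power series have distinct
  truncations of every sufficiently large order.

## References

* J. Bochnak, M. Coste, M.-F. Roy, *Real Algebraic Geometry*, Springer 1998, §8.1. [BochnakCosteRoy1998]
* J. Kollár, *Lectures on Resolution of Singularities*, Ann. of Math. Stud. 166 (2007), 1.94. [Kollar2007]
-/

noncomputable section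

namespace Literature.FieldTheory.AlgClosed

open Polynomial PowerSeries

variable {K : Type*} [Field K]

/-- The coercion `K[s] → K⟦s⟧` followed by the constant coefficient is evaluation at `0`.
[folklore] -/
theorem constantCoeff_coe_eq_eval_zero (p : K[X]) :
    PowerSeries.constantCoeff (p : K⟦X⟧) = p.eval 0 := by
  rw [Polynomial.constantCoeff_coe, Polynomial.coeff_zero_eq_eval_zero]

/-- A power series splits as its truncation below degree `N` plus `sᴺ` times a tail.
[folklore] -/
theorem coe_trunc_add_X_pow_mul (N : ℕ) (w : K⟦X⟧) :
    ((PowerSeries.trunc N w : K[X]) : K⟦X⟧) + (X : K⟦X⟧) ^ N * PowerSeries.mk (fun n => coeff (n + N) w) = w := by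
  ext n
  rw [map_add, Polynomial.coeff_coe, PowerSeries.coeff_trunc, PowerSeries.coeff_X_pow_mul']
  split_ifs with h1 h2 h2
  · omega
  · simp
  · rw [PowerSeries.coeff_mk, Nat.sub_add_cancel h2, zero_add]
  · omega

/-- A polynomial over `K[s]` is divisible by the constant `sᵉ` as soon as its image over
`K⟦s⟧` is. [folklore] -/
theorem C_X_pow_dvd_of_map {e : ℕ} {H : K[X][X]} {GL : K⟦X⟧[X]}
    (h : H.map (Polynomial.coeToPowerSeries.ringHom : K[X] →+* K⟦X⟧) =
      Polynomial.C ((X : K⟦X⟧) ^ e) * GL) :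
    Polynomial.C ((X : K[X]) ^ e) ∣ H := by
  rw [Polynomial.C_dvd_iff_dvd_coeff]
  intro i
  rw [Polynomial.X_pow_dvd_iff]
  intro d hd
  have hi := congrArg (fun p => p.coeff i) h
  simp only [Polynomial.coeff_map, Polynomial.coeff_C_mul] at hi
  have hcoe : (Polynomial.coeToPowerSeries.ringHom : K[X] →+* K⟦X⟧) (H.coeff i) =
      ((H.coeff i : K[X]) : K⟦X⟧) := rfl
  have := congrArg (fun φ : K⟦X⟧ => coeff d φ) hi
  simp only [hcoe, Polynomial.coeff_coe, PowerSeries.coeff_X_pow_mul', if_neg (not_le.mpr hd)] at this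
  exact this

/-- **The étale Taylor shift of a simple formal root.** For `F ∈ K[s][Y]` and a simple root
`w ∈ K⟦s⟧` of `F` (over `K⟦s⟧`), and any `N₀`, there are `N ≥ N₀`, `e` and `G ∈ K[s][Y]` with
`F(s, T(s) + sᴺ·Y) = sᵉ · G(s, Y)` where `T` is the truncation of `w` below degree `N`, and the
point `(0, w_N)` is an étale point of `G = 0`: `G(0, w_N) = 0`, `∂_Y G(0, w_N) ≠ 0`.
[cite: BochnakCosteRoy1998, §8.1] -/
theorem exists_etaleShift (F : K[X][X]) (w : K⟦X⟧)
    (hroot : (F.map (Polynomial.coeToPowerSeries.ringHom : K[X] →+* K⟦X⟧)).eval w = 0)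
    (hsimple : (Polynomial.derivative
      (F.map (Polynomial.coeToPowerSeries.ringHom : K[X] →+* K⟦X⟧))).eval w ≠ 0)
    (N₀ : ℕ) :
    ∃ (N e : ℕ) (G : K[X][X]), N₀ ≤ N ∧
      F.comp (Polynomial.C (PowerSeries.trunc N w) + Polynomial.C ((X : K[X]) ^ N) * Polynomial.X) =
        Polynomial.C ((X : K[X]) ^ e) * G ∧
      (G.map (Polynomial.evalRingHom 0)).eval (coeff N w) = 0 ∧
      (Polynomial.derivative (G.map (Polynomial.evalRingHom 0))).eval (coeff N w) ≠ 0 := by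
  set ι : K[X] →+* K⟦X⟧ := Polynomial.coeToPowerSeries.ringHom with hι
  set FL : K⟦X⟧[X] := F.map ι with hFL
  set c₁ : K⟦X⟧ := (Polynomial.derivative FL).eval w with hc₁
  -- the order `m` of `c₁ = ∂_Y F(s, w)`
  have hc₁0 : c₁ ≠ 0 := hsimple
  set m : ℕ := c₁.order.toNat with hm
  obtain ⟨c₁', hc₁'⟩ : (X : K⟦X⟧) ^ m ∣ c₁ := PowerSeries.X_pow_order_dvd
  have hc₁'0 : PowerSeries.constantCoeff c₁' ≠ 0 := by
    have h := PowerSeries.coeff_order hc₁0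
    rw [← hm, hc₁', PowerSeries.coeff_X_pow_mul', if_pos le_rfl, Nat.sub_self] at h
    simpa using h
  -- the shift order `N` and the decomposition `w = T + sᴺ u`
  set N : ℕ := max N₀ (m + 1) with hN
  have hN₀ : N₀ ≤ N := le_max_left _ _
  obtain ⟨d, hd⟩ : ∃ d : ℕ, N = m + 1 + d := ⟨N - (m + 1), by omega⟩
  set T : K[X] := PowerSeries.trunc N w with hT
  set u : K⟦X⟧ := PowerSeries.mk (fun n => coeff (n + N) w) with hu
  have hw : (T : K⟦X⟧) + (X : K⟦X⟧) ^ N * u = w := coe_trunc_add_X_pow_mul N w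
  have hu0 : PowerSeries.constantCoeff u = coeff N w := by
    rw [← PowerSeries.coeff_zero_eq_constantCoeff_apply, hu, PowerSeries.coeff_mk, zero_add]
  -- Taylor expansion of `FL` at `w`: `taylor w FL = X * (Q₂ * X + C c₁)`
  set P₁ : K⟦X⟧[X] := Polynomial.taylor w FL with hP₁
  have hP₁0 : P₁.coeff 0 = 0 := by rw [hP₁, Polynomial.taylor_coeff_zero]; exact hroot
  have hP₁1 : P₁.coeff 1 = c₁ := by rw [hP₁, Polynomial.taylor_coeff_one]
  set Q₁ : K⟦X⟧[X] := Polynomial.divX P₁ with hQ₁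
  set Q₂ : K⟦X⟧[X] := Polynomial.divX Q₁ with hQ₂
  have hP₁eq : P₁ = (Q₂ * Polynomial.X + Polynomial.C c₁) * Polynomial.X := by
    have h1 : Q₁ * Polynomial.X + Polynomial.C (P₁.coeff 0) = P₁ := Polynomial.divX_mul_X_add P₁
    have h2 : Q₂ * Polynomial.X + Polynomial.C (Q₁.coeff 0) = Q₁ := Polynomial.divX_mul_X_add Q₁
    have hQ₁0 : Q₁.coeff 0 = c₁ := by rw [hQ₁, Polynomial.coeff_divX, zero_add, hP₁1]
    rw [hP₁0, map_zero, add_zero] at h1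
    rw [hQ₁0] at h2
    rw [← h1, ← h2]
  -- the substitution `q = sᴺ (Y − u)` and the key identity over `K⟦s⟧`
  set a : K⟦X⟧ := (X : K⟦X⟧) ^ N with ha
  set q : K⟦X⟧[X] := Polynomial.C a * (Polynomial.X - Polynomial.C u) with hq
  set H : K[X][X] := F.comp (Polynomial.C T + Polynomial.C ((X : K[X]) ^ N) * Polynomial.X) with hH
  have hHmap : H.map ι = P₁.comp q := by
    rw [hH, Polynomial.map_comp, Polynomial.map_add, Polynomial.map_mul, Polynomial.map_C,
      Polynomial.map_C, Polynomial.map_X, map_pow, hP₁, Polynomial.taylor_apply, Polynomial.comp_assoc]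
    congr 1
    have hιT : ι T = (T : K⟦X⟧) := rfl
    have hιX : ι X = (X : K⟦X⟧) := by rw [hι]; simp
    rw [hιT, hιX, Polynomial.add_comp, Polynomial.X_comp, Polynomial.C_comp, hq, ← hw, ha]
    simp only [map_add, map_mul]
    ring
  -- `P₁.comp q = C (Xᵉ) * GL`, `e = N + m`
  set e : ℕ := N + m with he
  set GL : K⟦X⟧[X] := Polynomial.C c₁' * (Polynomial.X - Polynomial.C u) +
    Polynomial.C ((X : K⟦X⟧) ^ (d + 1)) * (Polynomial.X - Polynomial.C u) ^ 2 * Q₂.comp q with hGL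
  have hkey : P₁.comp q = Polynomial.C ((X : K⟦X⟧) ^ e) * GL := by
    rw [hP₁eq, Polynomial.mul_comp, Polynomial.add_comp, Polynomial.mul_comp, Polynomial.X_comp,
      Polynomial.C_comp, hGL, hq, ha, hc₁', he, hd]
    simp only [map_mul, map_pow, pow_add, pow_one]
    ring
  have hHmap' : H.map ι = Polynomial.C ((X : K⟦X⟧) ^ e) * GL := hHmap.trans hkey
  -- descend the divisibility to `K[s][Y]`
  obtain ⟨G, hG⟩ : Polynomial.C ((X : K[X]) ^ e) ∣ H := C_X_pow_dvd_of_map hHmap'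
  have hGmap : G.map ι = GL := by
    have h1 : H.map ι = Polynomial.C ((X : K⟦X⟧) ^ e) * G.map ι := by
      rw [hG, Polynomial.map_mul, Polynomial.map_C, map_pow]
      congr 2
      rw [hι]; simp
    have hne : (Polynomial.C ((X : K⟦X⟧) ^ e) : K⟦X⟧[X]) ≠ 0 :=
      Polynomial.C_ne_zero.mpr (pow_ne_zero _ PowerSeries.X_ne_zero)
    exact mul_left_cancel₀ hne (h1.symm.trans hHmap')
  -- evaluate at `s = 0`
  set π : K⟦X⟧ →+* K := PowerSeries.constantCoeff with hπ
  have hπι : π.comp ι = Polynomial.evalRingHom 0 := by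
    refine Polynomial.ringHom_ext (fun x => ?_) ?_
    · rw [RingHom.comp_apply, Polynomial.coe_evalRingHom, Polynomial.eval_C]
      change PowerSeries.constantCoeff ((Polynomial.C x : K[X]) : K⟦X⟧) = x
      rw [Polynomial.coe_C, PowerSeries.constantCoeff_C]
    · rw [RingHom.comp_apply, Polynomial.coe_evalRingHom, Polynomial.eval_X]
      change PowerSeries.constantCoeff ((Polynomial.X : K[X]) : K⟦X⟧) = 0
      rw [Polynomial.coe_X, PowerSeries.constantCoeff_X]
  have hG0 : G.map (Polynomial.evalRingHom 0) =
      Polynomial.C (π c₁') * (Polynomial.X - Polynomial.C (coeff N w)) := by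
    rw [← hπι, ← Polynomial.map_map, hGmap, hGL]
    have hπX : π ((X : K⟦X⟧) ^ (d + 1)) = 0 := by
      rw [map_pow, hπ, PowerSeries.constantCoeff_X, zero_pow (Nat.succ_ne_zero d)]
    simp only [Polynomial.map_add, Polynomial.map_mul, Polynomial.map_sub, Polynomial.map_pow,
      Polynomial.map_C, Polynomial.map_X, hπX, map_zero, zero_mul, add_zero]
    rw [hπ, hu0]
  refine ⟨N, e, G, hN₀, hG, ?_, ?_⟩
  · rw [hG0]
    simp
  · rw [hG0]
    simp only [Polynomial.derivative_mul, Polynomial.derivative_C, zero_mul, zero_add,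
      Polynomial.derivative_sub, Polynomial.derivative_X, sub_zero, mul_one, Polynomial.eval_C]
    exact hc₁'0

/-- Distinct power series have distinct truncations below every sufficiently large degree.
[folklore] -/
theorem trunc_ne_trunc_of_ne {w w' : K⟦X⟧} (h : w ≠ w') :
    ∃ N₀ : ℕ, ∀ N, N₀ ≤ N → PowerSeries.trunc N w ≠ PowerSeries.trunc N w' := by
  obtain ⟨i, hi⟩ : ∃ i, coeff i w ≠ coeff i w' := by
    by_contra hcon
    exact h (PowerSeries.ext fun n => not_not.mp fun hne => hcon ⟨n, hne⟩)
  refine ⟨i + 1, fun N hN heq => hi ?_⟩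
  have := congrArg (fun p : K[X] => p.coeff i) heq
  simp only [PowerSeries.coeff_trunc, if_pos (show i < N by omega)] at this
  exact this

end Literature.FieldTheory.AlgClosed

end
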